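import Summits.CriticalPhenomena.Ising3DConformalLimit.Theses.CurrentConnectionInvariance
import Literature.Probability.LatticeModels.ConformalCovariance
import Mathlib.Geometry.Euclidean.Inversion.Basic
import HarnessLib

/-!
# Crux `LinkingParityCircles.SpinRatioMoebius` (stmt-CriticalPhenomena-4530), line `registered` —
# stub `stub_CCIRatioInversionOfLimit`: item 4840 `RatioInversionInvariance` from the telescoping
# ratio limits of an inversion covariant family

Write `R^δ_n(z) = G^δ_n(z₀,…,z_{n-1}) G^δ_2(z_n, z_{n+1}) / G^δ_{n+2}(z)` for the weight-free telescoping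
ratio of critical 3D Ising spin correlators at mesh `δ` (spelled with
`rescaledCorrelator (criticalCorr 3) 1`) and `ι = EuclideanGeometry.inversion 0 1` for the unit
inversion.  Assume a continuum family `S` is inversion covariant with weight `Δ`
(`IsInversionCovariant Δ S`) and that, at every even level `n`, `R^δ_n → p_n := S_n S_2 / S_{n+2}`
locally uniformly on `NonCoincident 3 (n + 2)` along `𝓝[>] 0`.  Then item stmt-CriticalPhenomena-4840
`CurrentConnectionInvariance.RatioInversionInvariance` holds: `R^δ_n(ι∘x) − R^δ_n(x) → 0` for every
even `n ≥ 2` and every non-coincident `x` avoiding `0`.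

Proof: locally uniform convergence gives pointwise convergence at `x` and at `ι∘x` (again
non-coincident, `ι` being injective), and the two limits agree because the Kelvin weights
`∏ ‖xᵢ‖^{2Δ}` of the three covariant factors multiply up (`Fin.prod_univ_add`) and cancel in the
ratio (`mul_div_mul_left`).  No positivity of `S` is needed (`a / 0 = 0` on both sides).

Reference for the covariance law: P. Di Francesco, P. Mathieu, D. Sénéchal, *Conformal Field Theory*
(Springer 1997), §4.3.1 eq. (4.62).
-/

noncomputable section

namespace Summit.CriticalPhenomena.Ising3DConformalLimit.Cruxes.SpinRatioMoebius.Birth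

open Literature.Probability.LatticeModels Filter Set EuclideanGeometry
open scoped Topology

namespace CCIRatioInversionOfLimit

/-- **The Kelvin weights cancel.** For an inversion covariant family `S` (weight `Δ`) the limit
ratio `S_n(x₀,…,x_{n-1}) S_2(x_n,x_{n+1}) / S_{n+2}(x)` is invariant under the unit inversion at every
configuration avoiding the origin: the weights `∏_{i<n} ‖xᵢ‖^{2Δ} · ∏_{i<2} ‖x_{n+i}‖^{2Δ}` of the
numerator equal the weight `∏_{i<n+2} ‖xᵢ‖^{2Δ}` of the denominator (`Fin.prod_univ_add`) and are
non-zero. [folklore] -/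
theorem limitRatio_inversion {Δ : ℝ} {S : CorrFamily 3} (hinv : IsInversionCovariant Δ S)
    {n : ℕ} (x : Fin (n + 2) → EuclideanSpace ℝ (Fin 3)) (hx0 : ∀ i, x i ≠ 0) :
    S n (fun i => inversion 0 1 (x (Fin.castAdd 2 i))) *
          S 2 (fun i => inversion 0 1 (x (Fin.natAdd n i))) /
        S (n + 2) (fun i => inversion 0 1 (x i)) =
      S n (fun i => x (Fin.castAdd 2 i)) * S 2 (fun i => x (Fin.natAdd n i)) / S (n + 2) x := by
  have e1 := hinv n (fun i => x (Fin.castAdd 2 i)) (fun i => hx0 _)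
  have e2 := hinv 2 (fun i => x (Fin.natAdd n i)) (fun i => hx0 _)
  have e3 := hinv (n + 2) x hx0
  have hw' : 0 < ∏ i : Fin n, ‖x (Fin.castAdd 2 i)‖ ^ (2 * Δ) :=
    Finset.prod_pos fun i _ => Real.rpow_pos_of_pos (norm_pos_iff.mpr (hx0 _)) _
  have hw'' : 0 < ∏ i : Fin 2, ‖x (Fin.natAdd n i)‖ ^ (2 * Δ) :=
    Finset.prod_pos fun i _ => Real.rpow_pos_of_pos (norm_pos_iff.mpr (hx0 _)) _
  rw [e1, e2, e3, Fin.prod_univ_add, mul_mul_mul_comm,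
    mul_div_mul_left _ _ (mul_pos hw' hw'').ne']

end CCIRatioInversionOfLimit

open CCIRatioInversionOfLimit in
/-- **Stub `stub_CCIRatioInversionOfLimit` (item stmt-CriticalPhenomena-4840 from telescoping limits
of an inversion covariant family).** If `S` is inversion covariant with weight `Δ` and, at every even
level `n`, the weight-free lattice ratios `R^δ_n = G^δ_n G^δ_2 / G^δ_{n+2}` of critical 3D Ising
converge locally uniformly on `NonCoincident 3 (n + 2)` to `S_n S_2 / S_{n+2}` as `δ → 0⁺`, then
`CurrentConnectionInvariance.RatioInversionInvariance` holds: `R^δ_n(ι∘x) − R^δ_n(x) → 0` for every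
even `n ≥ 2` and every non-coincident `x` avoiding `0` (pointwise limits at `x` and `ι∘x`, equal by
`limitRatio_inversion`). [folklore] -/
theorem stub_CCIRatioInversionOfLimit : ∀ (Δ : ℝ) (S : Literature.Probability.LatticeModels.CorrFamily 3), Literature.Probability.LatticeModels.IsInversionCovariant Δ S → (∀ n : ℕ, Even n → TendstoLocallyUniformlyOn (fun (δ : ℝ) (z : Fin (n + 2) → EuclideanSpace ℝ (Fin 3)) => Literature.Probability.LatticeModels.rescaledCorrelator (Literature.Probability.LatticeModels.criticalCorr 3) 1 n δ (fun i => z (Fin.castAdd 2 i)) * Literature.Probability.LatticeModels.rescaledCorrelator (Literature.Probability.LatticeModels.criticalCorr 3) 1 2 δ (fun i => z (Fin.natAdd n i)) / Literature.Probability.LatticeModels.rescaledCorrelator (Literature.Probability.LatticeModels.criticalCorr 3) 1 (n + 2) δ z) (fun z => S n (fun i => z (Fin.castAdd 2 i)) * S 2 (fun i => z (Fin.natAdd n i)) / S (n + 2) z) (nhdsWithin 0 (Set.Ioi 0)) (Literature.Probability.LatticeModels.NonCoincident 3 (n + 2))) → Summit.CriticalPhenomena.Ising3DConformalLimit.Theses.CurrentConnectionInvariance.RatioInversionInvariance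 := by
  intro Δ S hinv hT n hn _h2 x hx hx0
  -- `ι∘x` is again non-coincident, `ι = inversion 0 1` being injective.
  have hιx : (fun i => inversion (0 : EuclideanSpace ℝ (Fin 3)) 1 (x i)) ∈ NonCoincident 3 (n + 2) := by
    rw [mem_nonCoincident] at hx ⊢
    exact (inversion_injective _ one_ne_zero).comp hx
  have h3 := ((hT n hn).tendsto_at hιx).sub ((hT n hn).tendsto_at hx)
  rw [limitRatio_inversion hinv x hx0, sub_self] at h3
  exact h3

end Summit.CriticalPhenomena.Ising3DConformalLimit.Cruxes.SpinRatioMoebius.Birth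

end
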